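import Summits.QuantumFields.YangMills.Theorems.BalabanUVNodesPortS1HalvesJacDefs
import Summits.QuantumFields.YangMills.Theorems.BalabanUVNodesPortS1HalvesGlue
import Summits.QuantumFields.YangMills.Theorems.BalabanUVNodesPortS1PathLetter

/-!
# NODE O port PT-A — GLUE FOR THE THREE-STUB SKELETON: `PortRecordLZHalf F` FROM ITS TWO SUB-HALVES (`PortRecordLZjacHalf`, `PortRecordLZdetHalf`), hence 27930⁸-Ax-LR4 from
# {LZjac, LZdet, FE}; and the two brackets of `Φ₁` ON THE GERM AT `B = 0` with ONLY POSITIVITY displayed (`phiLZdet = −½[log det T(B) − log det T(0)]` under the letters)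

Cell `ym-nodeO-ideate`, porter seat `ymgap-nodeO-port-PTA-1` (gen 5); `--supports stmt-QuantumFields-27930` (helper; the composition of the RESHAPED skeleton `pta_residueW` — stubs `stub_LZjac`,
`stub_LZdet`, `stub_FE` — concludes the crux through `sig27930v8LR4_of_three`).  [I] = [Balaban1987RG1].
CONSUMED BY NAME: `…HalvesJacDefs` (`phiLZjac`, `phiLZdet`, `phiLZjac_add_phiLZdet`, `PortRecordLZjacHalf`, `PortRecordLZdetHalf`), ✓p809031 `sig27930v8LR4_of_halves` ∕ `residueAtW_anti_radii`,
✓p803140 `residueAtW_add` ∕ `representsW_congr`, ✓p803341 `residueAtW_mono`, ✓p811030 `phiLZ_eq_logDet_sum₀`, ✓p811962 `eventually_recordB0BlockInvertible_portVkAx`.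
* §1 ★★★ `lzHalf_of_jac_det : (∀ F, LZjac F) → (∀ F, LZdet F) → ∀ F, PortRecordLZHalf F` (`Mth := max`, `κ, radii := min`, `E₁ := E₁ + E₂`, `residueAtW_add`, the split `phiLZ = phiLZjac + phiLZdet`);
  ★★★ `sig27930v8LR4_of_three`.
* §2 ★ `phiLZdet_eq_logDet₀` (under the letter at `W_B` and positivity at `W_B`, `W_0`: `phiLZdet n B = −½[log det T(B) − log det T(0)]`), ★★ `eventually_phiLZdet_eq_logDet` and ★★ `eventually_phiLZ_eq_logDet_sum`
  (on the germ at `B = 0`, from ⁸'s TokE + TokP9-reg shapes, with ONLY `PosDef recordPreckLoc` at `W_B` and `W_0` displayed).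

HONEST FRAMING.  Glue and bookkeeping; NOTHING of Bałaban asserted or proved; none of the three stubs is proved here; `PortRecordLZdetHalf` BLOCKED-ON P0 (α)+(β), `PortRecordFEHalf` XXL,
`PortRecordLZjacHalf` OPEN (P0-free); 27930 OPEN · no claim; K0⁷∕K-Ax OPEN; NODE O 0∕1; COUNT 8∕28 · K 1∕4 UNMOVED; finite `𝕋⁴_{L^K}` at fixed ε — NOT continuum ∕ OS ∕ Clay; **the Yang–Mills mass gap
is NOT proved by any of this.**  No `sorry`, no `def`, no `instance`, no `notation`; standard axioms.
-/

noncomputable section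

open scoped BigOperators Matrix.Norms.L2Operator Topology

namespace Summit.QuantumFields.YangMills.Theorems.BalabanUVNodesPortS1

open Summit.QuantumFields.YangMills.Theorems.K0RecordFormatNames
open Literature.MathematicalPhysics.QuantumFieldTheory.Balaban1983to89
open Literature.MathematicalPhysics.QuantumFieldTheory.Balaban1983to89.Node00
open Literature.MathematicalPhysics.QuantumFieldTheory.Balaban1983to89.T4Continuum (T4Family)
open _root_.Matrix _root_.Filter

/-! ## §1  ★★★ The LZ half from its two sub-halves; the signed text from three stubs -/

/-- ★★★ **`PortRecordLZHalf F` FROM THE δ-JACOBIAN SUB-HALF AND THE GAUSSIAN SUB-HALF** (every `F`): `Mth := max`, `κ := min`, radii `:= min` (`residueAtW_mono`, `residueAtW_anti_radii`), `E₁ := E₁ + E₂`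
(`residueAtW_add`), and the represented functional `phiLZ = phiLZjac + phiLZdet` (`representsW_congr`, by construction). [cite: Balaban1987RG1, (2.12) p.268, (1.4) p.260, (1.18) p.263] -/
theorem lzHalf_of_jac_det (hJ : ∀ F, PortRecordLZjacHalf F) (hD : ∀ F, PortRecordLZdetHalf F) : ∀ F, PortRecordLZHalf F := by
  intro F
  obtain ⟨M₁, H₁⟩ := hJ F
  obtain ⟨M₂, H₂⟩ := hD F
  refine ⟨max M₁ M₂, fun Mc hMc j c c₀ c₁ B₃ B₃' a₀ a₁ hG h₁ h₂ h₃ h₄ h₅ h₆ h₇ hT8 hT9 hTE hP9 hP9L ε₂₉ hε => ?_⟩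
  obtain ⟨E₁, κ₁, α₀, α₁, hE₁, hκ₁, hα₀, hα₁, HJ⟩ :=
    H₁ Mc (le_of_max_le_left hMc) j c c₀ c₁ B₃ B₃' a₀ a₁ hG h₁ h₂ h₃ h₄ h₅ h₆ h₇ hT8 hT9 hTE hP9 hP9L ε₂₉ hε
  obtain ⟨E₂, κ₂, β₀, β₁, hE₂, hκ₂, hβ₀, hβ₁, HD⟩ :=
    H₂ Mc (le_of_max_le_right hMc) j c c₀ c₁ B₃ B₃' a₀ a₁ hG h₁ h₂ h₃ h₄ h₅ h₆ h₇ hT8 hT9 hTE hP9 hP9L ε₂₉ hε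
  refine ⟨E₁ + E₂, min κ₁ κ₂, min α₀ β₀, min α₁ β₁, add_nonneg hE₁ hE₂, le_min hκ₁ hκ₂, lt_min hα₀ hβ₀, lt_min hα₁ hβ₁, fun k => ?_⟩
  obtain ⟨Ψ₁, Ew₁, hR₁⟩ := HJ k
  obtain ⟨Ψ₂, Ew₂, hR₂⟩ := HD k
  have h := residueAtW_add F Ψ₁ Ψ₂ Ew₁ Ew₂ a₀ ε₂₉ (min α₀ β₀) (min α₁ β₁) E₁ E₂ (min κ₁ κ₂) (phiLZjac F Mc a₀ ε₂₉ k) (phiLZdet F Mc a₀ ε₂₉ k)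
    (residueAtW_anti_radii (residueAtW_mono hR₁ le_rfl (min_le_left _ _) hE₁) (min_le_left _ _) (min_le_left _ _))
    (residueAtW_anti_radii (residueAtW_mono hR₂ le_rfl (min_le_right _ _) hE₂) (min_le_right _ _) (min_le_right _ _))
  refine ⟨Ψ₁.add Ψ₂, fun n X φ => Ew₁ n X φ + Ew₂ n X φ, h.1, h.2.1, h.2.2.1, h.2.2.2.1, h.2.2.2.2.1, h.2.2.2.2.2.1, ?_⟩
  exact representsW_congr F _ _ a₀ ε₂₉ (phiLZ F Mc a₀ ε₂₉ k) (fun n B => phiLZjac F Mc a₀ ε₂₉ k n B + phiLZdet F Mc a₀ ε₂₉ k n B)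
    (fun n => Eventually.of_forall fun B => phiLZjac_add_phiLZdet F Mc a₀ ε₂₉ k n B) h.2.2.2.2.2.2

/-- ★★★ **27930⁸-Ax-LR4 FROM THREE STUBS**: the δ-Jacobian sub-half, the Gaussian sub-half and the fluctuation-expansion half give the signed text for every torus family
(`sig27930v8LR4_of_halves ∘ lzHalf_of_jac_det`). [cite: Balaban1987RG1, (2.12)–(2.14) p.268, Thm 3 p.264; Balaban1988RG2Cluster, p.21] -/
theorem sig27930v8LR4_of_three (hJ : ∀ F, PortRecordLZjacHalf F) (hD : ∀ F, PortRecordLZdetHalf F) (hFE : ∀ F, PortRecordFEHalf F) :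
    ∀ F, Summit.QuantumFields.YangMills.Theorems.PortHRecordJoin.Sig8LR4 F :=
  sig27930v8LR4_of_halves (lzHalf_of_jac_det hJ hD) hFE

/-! ## §2  The Gaussian bracket in closed form under the letters; both brackets on the germ at `B = 0` with only positivity displayed -/

section Germ

variable (F : T4Family)

open Classical in
/-- ★ **`phiLZdet` IS THE GAUSSIAN BRACKET** under the letter at `W_B` and positivity at `W_B`, `W_0`: `phiLZdet n B = −½[log det T(B) − log det T(0)]`, `T = recordPreckLoc` at the record's background
with the porter's `h` (`phiLZ_eq_logDet_sum₀` minus the δ-Jacobian bracket, which is `phiLZjac` by definition). [cite: Balaban1987RG1, (2.11)–(2.12) p.267–268, (1.4) p.260] -/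
theorem phiLZdet_eq_logDet₀ (Mc : ℕ) (a₀ ε₂₉ : ℝ) (k n : ℕ) (B : recordW F a₀ ε₂₉ k (recordK₀ F Mc k + n))
    (hA : RecordB0BlockInvertible F k (recordK₀ F Mc k + n) (portVkAx F a₀ ε₂₉ k (recordK₀ F Mc k + n) B))
    (hP : (recordPreckLoc F k (recordK₀ F Mc k + n) (thetaFill F a₀ ε₂₉).εbg (portVkAx F a₀ ε₂₉ k (recordK₀ F Mc k + n) B)
      (hopLinGraph F k (recordK₀ F Mc k + n) (portVkAx F a₀ ε₂₉ k (recordK₀ F Mc k + n) B))).PosDef)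
    (hP₀ : letI θ := thetaFill F a₀ ε₂₉; letI := θ.instVβ₁; letI := θ.instVβ₂;
      (recordPreckLoc F k (recordK₀ F Mc k + n) (thetaFill F a₀ ε₂₉).εbg (portVkAx F a₀ ε₂₉ k (recordK₀ F Mc k + n) 0)
        (hopLinGraph F k (recordK₀ F Mc k + n) (portVkAx F a₀ ε₂₉ k (recordK₀ F Mc k + n) 0))).PosDef) :
    letI θ := thetaFill F a₀ ε₂₉; letI := θ.instVβ₁; letI := θ.instVβ₂;
    phiLZdet F Mc a₀ ε₂₉ k n B =
      ((-(1 / 2 : ℝ) * (Real.log (recordPreckLoc F k (recordK₀ F Mc k + n) (thetaFill F a₀ ε₂₉).εbg (portVkAx F a₀ ε₂₉ k (recordK₀ F Mc k + n) B)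
            (hopLinGraph F k (recordK₀ F Mc k + n) (portVkAx F a₀ ε₂₉ k (recordK₀ F Mc k + n) B))).det
          - Real.log (recordPreckLoc F k (recordK₀ F Mc k + n) (thetaFill F a₀ ε₂₉).εbg (portVkAx F a₀ ε₂₉ k (recordK₀ F Mc k + n) 0)
            (hopLinGraph F k (recordK₀ F Mc k + n) (portVkAx F a₀ ε₂₉ k (recordK₀ F Mc k + n) 0))).det) : ℝ) : ℂ) := by
  letI θ := thetaFill F a₀ ε₂₉; letI := θ.instVβ₁; letI := θ.instVβ₂
  have h := phiLZ_eq_logDet_sum₀ F Mc a₀ ε₂₉ k n B hA hP hP₀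
  rw [phiLZdet, h, phiLZjac]
  simp only [jacFactor]
  push_cast
  ring

open Classical in
/-- ★★ **THE GAUSSIAN BRACKET ON THE GERM AT `B = 0` WITH ONLY POSITIVITY DISPLAYED**: under the TokE and TokP9-reg shapes of ⁸'s antecedent (at the volume `recordK₀ F Mc k + n`), eventually near
`B = 0`: `PosDef T(B) → PosDef T(0) → phiLZdet n B = −½[log det T(B) − log det T(0)]` (the letter at `W_B` by ✓p811962). [cite: Balaban1987RG1, (2.11)–(2.12) p.267–268; Balaban1985Variational, Thm 1 p.279, Prop. 9 p.309] -/
theorem eventually_phiLZdet_eq_logDet (Mc : ℕ) (a₀ ε₂₉ : ℝ) (k n : ℕ) {ε₁ : ℝ} (hε₁ : 0 < ε₁)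
    (hTokE : ∀ V : GaugeField (F.P (recordK₀ F Mc k + n)) (k + 1) (SU 2), PlaqSmall ε₁ V →
      UkExists F 2 (recordK₀ F Mc k + n) (k + 1) a₀ V ∧ UniqueUkOrbit F 2 (recordK₀ F Mc k + n) (k + 1) a₀ V)
    (hP9 : letI θ := thetaFill F a₀ ε₂₉; letI := θ.instVβ₁; letI := θ.instVβ₂
      AnalyticAt ℝ (fun B : recordW F a₀ ε₂₉ k (recordK₀ F Mc k + n) => fun (b : PBond (F.P (recordK₀ F Mc k + n)) 0) (i i' : Fin 2) =>
        ((recordBgField F θ k (recordK₀ F Mc k + n) B b : SU 2) : Matrix (Fin 2) (Fin 2) ℂ) i i') 0) :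
    letI θ := thetaFill F a₀ ε₂₉; letI := θ.instVβ₁; letI := θ.instVβ₂;
    ∀ᶠ B in 𝓝 (0 : recordW F a₀ ε₂₉ k (recordK₀ F Mc k + n)),
      (recordPreckLoc F k (recordK₀ F Mc k + n) (thetaFill F a₀ ε₂₉).εbg (portVkAx F a₀ ε₂₉ k (recordK₀ F Mc k + n) B)
          (hopLinGraph F k (recordK₀ F Mc k + n) (portVkAx F a₀ ε₂₉ k (recordK₀ F Mc k + n) B))).PosDef →
        (recordPreckLoc F k (recordK₀ F Mc k + n) (thetaFill F a₀ ε₂₉).εbg (portVkAx F a₀ ε₂₉ k (recordK₀ F Mc k + n) 0)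
            (hopLinGraph F k (recordK₀ F Mc k + n) (portVkAx F a₀ ε₂₉ k (recordK₀ F Mc k + n) 0))).PosDef →
          phiLZdet F Mc a₀ ε₂₉ k n B =
            ((-(1 / 2 : ℝ) * (Real.log (recordPreckLoc F k (recordK₀ F Mc k + n) (thetaFill F a₀ ε₂₉).εbg (portVkAx F a₀ ε₂₉ k (recordK₀ F Mc k + n) B)
                  (hopLinGraph F k (recordK₀ F Mc k + n) (portVkAx F a₀ ε₂₉ k (recordK₀ F Mc k + n) B))).det
                - Real.log (recordPreckLoc F k (recordK₀ F Mc k + n) (thetaFill F a₀ ε₂₉).εbg (portVkAx F a₀ ε₂₉ k (recordK₀ F Mc k + n) 0)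
                  (hopLinGraph F k (recordK₀ F Mc k + n) (portVkAx F a₀ ε₂₉ k (recordK₀ F Mc k + n) 0))).det) : ℝ) : ℂ) := by
  letI θ := thetaFill F a₀ ε₂₉; letI := θ.instVβ₁; letI := θ.instVβ₂
  filter_upwards [eventually_recordB0BlockInvertible_portVkAx F a₀ ε₂₉ (succ_le_m_add_K_recordK₀ F Mc k n) hε₁ hTokE hP9] with B hA hP hP₀
  exact phiLZdet_eq_logDet₀ F Mc a₀ ε₂₉ k n B hA hP hP₀

open Classical in
/-- ★★ **BOTH BRACKETS OF `Φ₁` ON THE GERM AT `B = 0` WITH ONLY POSITIVITY DISPLAYED** (`phiLZ_eq_logDet_sum₀` with its `hA` discharged by ✓p811962 along the path).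
[cite: Balaban1987RG1, (2.12) p.268, (1.4) p.260, p.267; Balaban1985Variational, Thm 1 p.279, Prop. 9 p.309] -/
theorem eventually_phiLZ_eq_logDet_sum (Mc : ℕ) (a₀ ε₂₉ : ℝ) (k n : ℕ) {ε₁ : ℝ} (hε₁ : 0 < ε₁)
    (hTokE : ∀ V : GaugeField (F.P (recordK₀ F Mc k + n)) (k + 1) (SU 2), PlaqSmall ε₁ V →
      UkExists F 2 (recordK₀ F Mc k + n) (k + 1) a₀ V ∧ UniqueUkOrbit F 2 (recordK₀ F Mc k + n) (k + 1) a₀ V)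
    (hP9 : letI θ := thetaFill F a₀ ε₂₉; letI := θ.instVβ₁; letI := θ.instVβ₂
      AnalyticAt ℝ (fun B : recordW F a₀ ε₂₉ k (recordK₀ F Mc k + n) => fun (b : PBond (F.P (recordK₀ F Mc k + n)) 0) (i i' : Fin 2) =>
        ((recordBgField F θ k (recordK₀ F Mc k + n) B b : SU 2) : Matrix (Fin 2) (Fin 2) ℂ) i i') 0) :
    letI θ := thetaFill F a₀ ε₂₉; letI := θ.instVβ₁; letI := θ.instVβ₂;
    ∀ᶠ B in 𝓝 (0 : recordW F a₀ ε₂₉ k (recordK₀ F Mc k + n)),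
      (recordPreckLoc F k (recordK₀ F Mc k + n) (thetaFill F a₀ ε₂₉).εbg (portVkAx F a₀ ε₂₉ k (recordK₀ F Mc k + n) B)
          (hopLinGraph F k (recordK₀ F Mc k + n) (portVkAx F a₀ ε₂₉ k (recordK₀ F Mc k + n) B))).PosDef →
        (recordPreckLoc F k (recordK₀ F Mc k + n) (thetaFill F a₀ ε₂₉).εbg (portVkAx F a₀ ε₂₉ k (recordK₀ F Mc k + n) 0)
            (hopLinGraph F k (recordK₀ F Mc k + n) (portVkAx F a₀ ε₂₉ k (recordK₀ F Mc k + n) 0))).PosDef →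
          phiLZ F Mc a₀ ε₂₉ k n B =
            ((-(1 / 2 : ℝ) * (Real.log (recordPreckLoc F k (recordK₀ F Mc k + n) (thetaFill F a₀ ε₂₉).εbg (portVkAx F a₀ ε₂₉ k (recordK₀ F Mc k + n) B)
                  (hopLinGraph F k (recordK₀ F Mc k + n) (portVkAx F a₀ ε₂₉ k (recordK₀ F Mc k + n) B))).det
                - Real.log (recordPreckLoc F k (recordK₀ F Mc k + n) (thetaFill F a₀ ε₂₉).εbg (portVkAx F a₀ ε₂₉ k (recordK₀ F Mc k + n) 0)
                  (hopLinGraph F k (recordK₀ F Mc k + n) (portVkAx F a₀ ε₂₉ k (recordK₀ F Mc k + n) 0))).det)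
              - ∑ c : PBond (F.P (recordK₀ F Mc k + n)) (k + 1),
                  (Real.log |(Matrix.of fun j j' : Fin 3 => recordLQtB0 F k (recordK₀ F Mc k + n) (portVkAx F a₀ ε₂₉ k (recordK₀ F Mc k + n) B) (c, j) (c, j')).det|
                    - Real.log |(Matrix.of fun j j' : Fin 3 => recordLQtB0 F k (recordK₀ F Mc k + n) (portVkAx F a₀ ε₂₉ k (recordK₀ F Mc k + n) 0) (c, j) (c, j')).det|) : ℝ) : ℂ) := by
  letI θ := thetaFill F a₀ ε₂₉; letI := θ.instVβ₁; letI := θ.instVβ₂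
  filter_upwards [eventually_recordB0BlockInvertible_portVkAx F a₀ ε₂₉ (succ_le_m_add_K_recordK₀ F Mc k n) hε₁ hTokE hP9] with B hA hP hP₀
  exact phiLZ_eq_logDet_sum₀ F Mc a₀ ε₂₉ k n B hA hP hP₀

end Germ

end Summit.QuantumFields.YangMills.Theorems.BalabanUVNodesPortS1

end
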